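import Summits.CriticalPhenomena.PercolationContinuityZ3.Theorems.Transplant.GrigorchukSubexponentialGrowth
import HarnessLib

/-!
# Subexponential growth, amenability and `p_u = p_c < 1` on EVERY Cayley graph of the first Grigorchuk group (change of finite generating set)

builds on p205010 (kernel theorem, internal audit signed; external expert review pending) — nothing in this file uses p205010; growth / amenability / the
HYPOTHESIS side of percolation only: no `θ(p_c)` statement, no node touched.  Lane `prim-bschramm`, seat `prim-bschramm-gen-1` gen 8 (GEN pen; offer O-GR, point
(iv) 'every S' of lead g25's GO 2026-08-28T05:41Z).  Helper file (`--supports stmt-CriticalPhenomena-4575 --as helper`).  Def-free; class rows only — no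
`@[conjecture]` declared, edited or claimed; nothing about `BenjaminiSchramm1996_conj4_endState` or the print nodes.  WORD DISCIPLINE as in
«GrigorchukSubexponentialGrowth»: UPPER bound only ('intermediate' NOT typed).

THE TRANSFER.  For a finite `S ⊆ 𝔊` every `s ∈ S` and its inverse are words of at most `W` letters `a, b, c, d` (`exists_word_of_mem`: `𝔊 = ⟨a,b,c,d⟩` and the
letters are involutions, so inverses are reversed words); a walk of length `n` in `Cay(𝔊; S)` (Mathlib `SimpleGraph.mulCayley ↑S`: `u ∼ u s^{±1}`) is therefore a word
of `≤ W n` letters, whence `|B_S(1, n)| ≤ γ_w(3400 W n)` and «GrigorchukSubexponentialGrowth» `gammaW_le_exp` kills every exponential rate: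
* **`not_hasExponentialGrowth_cayley_gens (S) : ¬ HasExponentialGrowth (Cay(𝔊; S))`** for EVERY finite `S ⊆ 𝔊` (generating or not);
* **`isGraphAmenable_cayley_gens (S)`** (quasi-transitivity of any `mulCayley`, Literature `hasExponentialGrowth_of_not_isGraphAmenable` contraposed);
* for generating `S`: **`uniquenessProb_eq_criticalProb_gens`** (Literature «UniquenessAmenable» p596858) and, with O-MP p607347,
  **`uniquenessProb_lt_one_gens (S) (hS : closure S = ⊤) : p_u(Cay(𝔊; S)) < 1`** — on every Cayley graph of `𝔊`.
[cite: Grigorchuk1984, Thm. (subexponential growth; independence of the generating set)] [cite: LyonsPeres2016, §6.1 p. 279; Thm. 7.6; §7.2 (word metrics of two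
finite generating sets are bi-Lipschitz)] [cite: BenjaminiSchramm1996, §2 Conj. 1; Question 3]
-/

noncomputable section

namespace Summit.CriticalPhenomena.PercolationContinuityZ3.Theorems.Transplant

namespace Grigorchuk

open SimpleGraph Filter Literature.Barriers.CriticalPhenomena Literature.Probability.Percolation Literature.Probability.LatticeModels
open scoped Classical Topology

/-! ## §1 Words for elements of `𝔊` and their inverses -/

/-- The letters are involutions. [cite: Grigorchuk1980, a² = b² = c² = d² = 1] -/
theorem Letter.toPerm_mul_self (ℓ : Letter) : ℓ.toPerm * ℓ.toPerm = 1 := by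
  rcases ℓ with _ | ⟨_ | _ | _⟩
  · exact Equiv.ext fun x => flipAt_involutive 0 x
  · exact (V4.toPerm_mul .b .b).symm
  · exact (V4.toPerm_mul .c .c).symm
  · exact (V4.toPerm_mul .d .d).symm

/-- The reversed word evaluates to the inverse. [folklore] -/
theorem prod_reverse (w : List Letter) : (w.reverse.map Letter.toPerm).prod = ((w.map Letter.toPerm).prod)⁻¹ := by
  induction w with
  | nil => simp
  | cons ℓ w ih =>
    rw [List.reverse_cons, List.map_append, List.prod_append, ih]
    simp only [List.map_cons, List.map_nil, List.prod_cons, List.prod_nil, mul_one, mul_inv_rev, inv_eq_of_mul_eq_one_right (Letter.toPerm_mul_self ℓ)]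

/-- **Every element of `𝔊` is a word in `a, b, c, d`.** [cite: Grigorchuk1980, definition of the group] -/
theorem exists_word_of_mem {g : Equiv.Perm Ray} (hg : g ∈ grigorchukGroup) : ∃ w : List Letter, (w.map Letter.toPerm).prod = g := by
  induction hg using Subgroup.closure_induction with
  | mem x hx =>
    simp only [Set.mem_insert_iff, Set.mem_singleton_iff] at hx
    rcases hx with rfl | rfl | rfl | rfl
    · exact ⟨[.a], by simp [Letter.toPerm]⟩
    · exact ⟨[.x .b], by simp [Letter.toPerm, BCD.toPerm, BCD.toV4, V4.toPerm]⟩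
    · exact ⟨[.x .c], by simp [Letter.toPerm, BCD.toPerm, BCD.toV4, V4.toPerm]⟩
    · exact ⟨[.x .d], by simp [Letter.toPerm, BCD.toPerm, BCD.toV4, V4.toPerm]⟩
  | one => exact ⟨[], by simp⟩
  | mul x y _ _ ihx ihy =>
    obtain ⟨u, hu⟩ := ihx
    obtain ⟨v, hv⟩ := ihy
    exact ⟨u ++ v, by rw [List.map_append, List.prod_append, hu, hv]⟩
  | inv x _ ihx =>
    obtain ⟨u, hu⟩ := ihx
    exact ⟨u.reverse, by rw [prod_reverse, hu]⟩

/-- **A uniform word-length bound for a finite subset of `𝔊` and its inverses.** [cite: LyonsPeres2016, §7.2 (two finite generating sets give bi-Lipschitz word metrics)] -/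
theorem exists_uniform_words (S : Finset ↥grigorchukGroup) :
    ∃ W : ℕ, ∀ s ∈ S, (∃ w : List Letter, w.length ≤ W ∧ (w.map Letter.toPerm).prod = (s : Equiv.Perm Ray)) ∧
      (∃ w : List Letter, w.length ≤ W ∧ (w.map Letter.toPerm).prod = ((s : Equiv.Perm Ray))⁻¹) := by
  choose f hf using fun s : ↥grigorchukGroup => exists_word_of_mem s.2
  refine ⟨S.sup fun s => (f s).length, fun s hs => ⟨⟨f s, Finset.le_sup (f := fun s => (f s).length) hs, hf s⟩,
    ⟨(f s).reverse, by rw [List.length_reverse]; exact Finset.le_sup (f := fun s => (f s).length) hs, by rw [prod_reverse, hf s]⟩⟩⟩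

/-! ## §2 Balls of `Cay(𝔊; S)` inside weighted balls -/

/-- A walk of length `k` in `Cay(𝔊; S)` is a word of `≤ W k` letters. [cite: LyonsPeres2016, §7.2 (word metrics)] -/
theorem exists_word_of_walk_gens (S : Finset ↥grigorchukGroup) {W : ℕ}
    (hW : ∀ s ∈ S, (∃ w : List Letter, w.length ≤ W ∧ (w.map Letter.toPerm).prod = (s : Equiv.Perm Ray)) ∧
      (∃ w : List Letter, w.length ≤ W ∧ (w.map Letter.toPerm).prod = ((s : Equiv.Perm Ray))⁻¹))
    {u v : ↥grigorchukGroup} (p : (mulCayley (↑S : Set ↥grigorchukGroup)).Walk u v) :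
    ∃ w : List Letter, w.length ≤ W * p.length ∧ (u : Equiv.Perm Ray) * (w.map Letter.toPerm).prod = (v : Equiv.Perm Ray) := by
  induction p with
  | nil => exact ⟨[], by simp, by simp⟩
  | @cons x y z hadj p ih =>
    obtain ⟨w, hw, hprod⟩ := ih
    rw [mulCayley_adj'] at hadj
    obtain ⟨-, s, hs, hxy⟩ := hadj
    obtain ⟨⟨w₁, hw₁, e₁⟩, ⟨w₂, hw₂, e₂⟩⟩ := hW s (Finset.mem_coe.1 hs)
    -- `y = x s` or `y = x s⁻¹`
    have hy : ∃ w₀ : List Letter, w₀.length ≤ W ∧ (y : Equiv.Perm Ray) = (x : Equiv.Perm Ray) * (w₀.map Letter.toPerm).prod := by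
      rcases hxy with h | h
      · exact ⟨w₁, hw₁, by rw [e₁, ← Subgroup.coe_mul, h]⟩
      · refine ⟨w₂, hw₂, ?_⟩
        rw [e₂, ← Subgroup.coe_inv, ← Subgroup.coe_mul, h, mul_inv_cancel_right]
    obtain ⟨w₀, hw₀, hy⟩ := hy
    refine ⟨w₀ ++ w, ?_, ?_⟩
    · rw [List.length_append, SimpleGraph.Walk.length_cons, Nat.mul_succ]; omega
    · rw [List.map_append, List.prod_append, ← mul_assoc, ← hy, hprod]

/-- **`|B_S(1, n)| ≤ γ_w(3400 W n)` in `Cay(𝔊; S)`, for some `W = W(S)`.** [cite: Grigorchuk1984, the growth function] -/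
theorem ballVolume_le_gammaW_gens (S : Finset ↥grigorchukGroup) :
    ∃ W : ℕ, ∀ n : ℕ, ballVolume (mulCayley (↑S : Set ↥grigorchukGroup)) 1 n ≤ gammaW (3400 * (W * n)) := by
  obtain ⟨W, hW⟩ := exists_uniform_words S
  refine ⟨W, fun n => ?_⟩
  unfold ballVolume gammaW
  rw [← Set.ncard_coe_finset]
  refine Set.ncard_le_ncard_of_injOn (fun g : ↥grigorchukGroup => (g : Equiv.Perm Ray)) (fun g hg => ?_) (fun _ _ _ _ h => Subtype.ext h)
    (Finset.finite_toSet _)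
  obtain ⟨p, hp⟩ := hg
  obtain ⟨w, hw, hprod⟩ := exists_word_of_walk_gens S hW p
  rw [Subgroup.coe_one, one_mul] at hprod
  show (g : Equiv.Perm Ray) ∈ (↑(wball (3400 * (W * n))) : Set (Equiv.Perm Ray))
  rw [Finset.mem_coe, ← hprod]
  have h1 := wordLW_le w
  have h2 : W * p.length ≤ W * n := Nat.mul_le_mul_left W hp
  exact wball_mono (by omega) (prod_mem_wball w)

/-- **EVERY Cayley graph `Cay(𝔊; S)` (`S ⊆ 𝔊` finite) FAILS TO HAVE EXPONENTIAL GROWTH.** [cite: Grigorchuk1984, Thm. (subexponential growth, any generating set)] -/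
theorem not_hasExponentialGrowth_cayley_gens (S : Finset ↥grigorchukGroup) :
    ¬ HasExponentialGrowth (mulCayley (↑S : Set ↥grigorchukGroup)) := by
  intro h
  obtain ⟨c, hc, hev⟩ := h 1
  obtain ⟨W, hW⟩ := ballVolume_le_gammaW_gens S
  have hc0 : 0 < c := by linarith
  set r : ℝ := Real.exp (Real.log c / 2) with hr
  have hr1 : 1 < r := by rw [hr]; exact Real.one_lt_exp_iff.2 (by have := Real.log_pos hc; linarith)
  have hr0 : 0 < r := by linarith
  have hrr : r * r = c := by rw [hr, ← Real.exp_add, add_halves, Real.exp_log hc0]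
  -- rate `τ = log c / (6800 (W+1))`: `τ · 3400 (W+1) n = (log c / 2) n`
  have hWp : (0 : ℝ) < (W : ℝ) + 1 := by positivity
  obtain ⟨K, hK⟩ := gammaW_le_exp (show 0 < Real.log c / (6800 * ((W : ℝ) + 1)) by have := Real.log_pos hc; positivity)
  have hbound : ∀ᶠ n : ℕ in atTop, r ^ n ≤ K := by
    filter_upwards [hev] with n hn
    have h1 : (ballVolume (mulCayley (↑S : Set ↥grigorchukGroup)) 1 n : ℝ) ≤ gammaW (3400 * ((W + 1) * n)) := by
      have := (hW n).trans (gammaW_mono (show 3400 * (W * n) ≤ 3400 * ((W + 1) * n) by nlinarith))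
      exact_mod_cast this
    have h2 := hK (3400 * ((W + 1) * n))
    have h3 : Real.exp (Real.log c / (6800 * ((W : ℝ) + 1)) * ((3400 * ((W + 1) * n) : ℕ) : ℝ)) = r ^ n := by
      rw [hr, ← Real.exp_nat_mul]; congr 1; push_cast; field_simp; ring
    rw [h3] at h2
    have h4 : c ^ n = r ^ n * r ^ n := by rw [← mul_pow, hrr]
    have h5 : r ^ n * r ^ n ≤ K * r ^ n := by rw [← h4]; exact hn.trans (h1.trans h2)
    exact le_of_mul_le_mul_right h5 (pow_pos hr0 n)
  have hgrow := (tendsto_pow_atTop_atTop_of_one_lt hr1).eventually_gt_atTop K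
  obtain ⟨n, hn1, hn2⟩ := (hbound.and hgrow).exists
  exact absurd hn1 (not_le.2 hn2)

/-! ## §3 Amenability and `p_u = p_c < 1` on every Cayley graph -/

/-- **Every `Cay(𝔊; S)` is amenable.** [cite: LyonsPeres2016, §6.1 p. 279 (nonamenable ⇒ exponential growth)] [cite: Grigorchuk1984, Thm. (subexponential growth)] -/
theorem isGraphAmenable_cayley_gens (S : Finset ↥grigorchukGroup) : IsGraphAmenable (mulCayley (↑S : Set ↥grigorchukGroup)) := by
  by_contra hna
  exact not_hasExponentialGrowth_cayley_gens S (hasExponentialGrowth_of_not_isGraphAmenable _ (CayleyScaled.isQuasiTransitive_mulCayley _) hna)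

/-- **`p_u = p_c` on every Cayley graph of `𝔊`** (the amenable case, a theorem in print — Lyons–Peres Thm. 7.6; nothing about Conj. 6 proper, the
nonamenable direction). [cite: LyonsPeres2016, Thm. 7.6] -/
theorem uniquenessProb_eq_criticalProb_gens (S : Finset ↥grigorchukGroup) (hS : Subgroup.closure (↑S : Set ↥grigorchukGroup) = ⊤) (g : ↥grigorchukGroup) :
    uniquenessProb (mulCayley (↑S : Set ↥grigorchukGroup)) = criticalProb (mulCayley (↑S : Set ↥grigorchukGroup)) g :=
  uniquenessProb_eq_criticalProb_of_amenable _ (CayleyScaled.connected_mulCayley_of_closure S hS) (CayleyScaled.isQuasiTransitive_mulCayley S)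
    (isGraphAmenable_cayley_gens S) g

/-- **`p_u(Cay(𝔊; S)) < 1` for EVERY finite generating set `S` of the first Grigorchuk group** (amenability + O-MP's `p_c < 1`, p607347) — kernel.  Nothing
about the print nodes Question 3 / Conj. 7.27 and nothing about `θ(p_c)`. [cite: LyonsPeres2016, Thm. 7.6] [cite: BenjaminiSchramm1996, Question 3 (p. 79)]
[cite: MuchnikPak2001, Thm. 1] -/
theorem uniquenessProb_lt_one_gens (S : Finset ↥grigorchukGroup) (hS : Subgroup.closure (↑S : Set ↥grigorchukGroup) = ⊤) :
    uniquenessProb (mulCayley (↑S : Set ↥grigorchukGroup)) < 1 := by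
  rw [uniquenessProb_eq_criticalProb_gens S hS 1]
  exact grigorchukGroup_criticalProb_lt_one S hS 1

end Grigorchuk

end Summit.CriticalPhenomena.PercolationContinuityZ3.Theorems.Transplant

end
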